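import Mathlib
import Summits.NavierStokesRegularity.NavierStokesRegularity.Theorems.FilamentSkeletonRssStadiumPairPositivity

/-!
# Sharp complexified-chord positivity along a complex segment (`TangentSkeletonNearStraightL`, stmt-NavierStokesRegularity-23320,
# registered stub `stub_stripPropagation` — principal branch of the matched kernel under the contour shift, END DESCENTS included)

For a stadium-analytic curve `F : ℂ → ℂ³` with the bilinear unit relation `∑ (F′)ᵢ² = 1` on an open set `U` containing the segment
`[z, z+s]` (`s ∈ ℂ`), write `F(z+s) − F(z) = s·W`, `W = ∫₀¹ F′(z+rs) dr`, so that the complexified chord is `Q = ∑ᵢ (Fᵢ(z+s) − Fᵢ(z))² = s²·P`,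
`P = ∑ Wᵢ² = ∫₀¹∫₀¹ ⟨F′(z+rs), F′(z+r′s)⟩ dr dr′` (bilinear).  Feeding the pair estimate `Theorems.StadiumPairPositivity.re_dot_ge_of_le` /
`abs_im_dot_le_of_le` pointwise: if along the segment a REAL unit tangent field `T r` (in the application `T r = X′(Re(z+rs))`) has oscillation
`‖T r − T r′‖ ≤ ρ`, the REAL parts of `F′` deviate from it by `≤ e` and the imaginary parts are bounded by `q`, then
  `Re P ≥ 1 − (ρ + 2e)²/2`, `|Im P| ≤ 2q(ρ + 2e)`,
and hence, for a displacement with `Re(s²) ≥ 0` (slope `< 1`),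
  `Re Q ≥ Re(s²)·(1 − (ρ+2e)²/2) − |Im(s²)|·2q(ρ+2e)`  (`segment_chord_re_ge`).
The imaginary deviation enters ONLY through the cross term with `Im(s²)`: horizontal chords (`s` real) need no bound on it at all, and the end
descents of slope `m` need `2q(ρ+2e)·2m/(1−m²) < 1 − (ρ+2e)²/2` — met with Cauchy estimates alone at output half-width `cs√Γ/8`
(slope `1/7`), for every `Rb ≤ 1/2`.  HONEST FRAMING: a tool for a HYPOTHETICAL filament skeleton on the NEGATIVE side of a MODEL route; nothing
here bears on Navier–Stokes regularity or blow-up.  `--supports stmt-NavierStokesRegularity-23320`.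
-/

set_option linter.dupNamespace false

noncomputable section

namespace Summit.NavierStokesRegularity.NavierStokesRegularity.Theorems.StadiumSegmentPositivity

open Set MeasureTheory intervalIntegral
open Summit.NavierStokesRegularity.NavierStokesRegularity.Theorems.StadiumPairPositivity

/-- Real part of an interval integral over `[0,1]` is at least `m` when the integrand's real part is, for a continuous integrand. [folklore] -/
theorem le_re_integral_of_le {f : ℝ → ℂ} (hf : ContinuousOn f (uIcc (0:ℝ) 1)) {m : ℝ}
    (h : ∀ r ∈ Icc (0:ℝ) 1, m ≤ (f r).re) : m ≤ (∫ r in (0:ℝ)..1, f r).re := by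
  have hre : (∫ r in (0:ℝ)..1, f r).re = ∫ r in (0:ℝ)..1, (f r).re := by
    have h1 := (Complex.reCLM.intervalIntegral_comp_comm (hf.intervalIntegrable (μ := volume)))
    simpa only [Complex.reCLM_apply] using h1.symm
  rw [hre]
  have hcont : ContinuousOn (fun r => (f r).re) (uIcc (0:ℝ) 1) := Complex.continuous_re.comp_continuousOn hf
  have hmono := intervalIntegral.integral_mono_on (μ := volume) zero_le_one
    (intervalIntegrable_const (c := m)) (hcont.intervalIntegrable) (fun r hr => h r hr)
  simpa using hmono

/-- Imaginary part of an interval integral over `[0,1]` is at most `m` in absolute value when the integrand's is. [folklore] -/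
theorem abs_im_integral_le_of_le {f : ℝ → ℂ} (hf : ContinuousOn f (uIcc (0:ℝ) 1)) {m : ℝ}
    (h : ∀ r ∈ Icc (0:ℝ) 1, |(f r).im| ≤ m) : |(∫ r in (0:ℝ)..1, f r).im| ≤ m := by
  have him : (∫ r in (0:ℝ)..1, f r).im = ∫ r in (0:ℝ)..1, (f r).im := by
    have h1 := (Complex.imCLM.intervalIntegral_comp_comm (hf.intervalIntegrable (μ := volume)))
    simpa only [Complex.imCLM_apply] using h1.symm
  rw [him]
  have hb : ∀ r ∈ Set.uIoc (0:ℝ) 1, ‖(f r).im‖ ≤ m := by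
    intro r hr
    have hr' : r ∈ Icc (0:ℝ) 1 := by
      have := uIoc_subset_uIcc hr; rwa [uIcc_of_le zero_le_one] at this
    simpa [Real.norm_eq_abs] using h r hr'
  have h2 := intervalIntegral.norm_integral_le_of_norm_le_const hb
  simpa [Real.norm_eq_abs] using h2

/-- **Sharp segment positivity (the `P`-level statement).**  `U` open, `F` differentiable on `U` with `∑ (F′)ᵢ² = 1`, the segment
`r ↦ z + r·s`, `r ∈ [0,1]`, inside `U`; a real unit tangent field `T` along it with oscillation `≤ ρ`, real-part deviation `≤ e`, imaginary
part `≤ q`.  Then `P = ∑ᵢ (∫₀¹ F′ᵢ(z+rs) dr)²` has `Re P ≥ 1 − (ρ+2e)²/2` and `|Im P| ≤ 2q(ρ+2e)`. [folklore] -/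
theorem segment_mean_sq_bounds {U : Set ℂ} (hU : IsOpen U) {F : ℂ → (Fin 3 → ℂ)} (hF : DifferentiableOn ℂ F U)
    (hunit : ∀ w ∈ U, ∑ i, (deriv F w i) ^ 2 = 1) {z s : ℂ} (hseg : ∀ r ∈ Icc (0:ℝ) 1, z + (r : ℂ) * s ∈ U)
    (T : ℝ → Fin 3 → ℝ) (hT : ∀ r ∈ Icc (0:ℝ) 1, ∑ i, T r i ^ 2 = 1) {ρ e q : ℝ}
    (hρ : ∀ r ∈ Icc (0:ℝ) 1, ∀ r' ∈ Icc (0:ℝ) 1, √(∑ i, (T r i - T r' i) ^ 2) ≤ ρ)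
    (he : ∀ r ∈ Icc (0:ℝ) 1, √(∑ i, ((deriv F (z + (r : ℂ) * s) i).re - T r i) ^ 2) ≤ e)
    (hq : ∀ r ∈ Icc (0:ℝ) 1, √(∑ i, (deriv F (z + (r : ℂ) * s) i).im ^ 2) ≤ q) :
    1 - (ρ + 2 * e) ^ 2 / 2 ≤ (∑ i, (∫ r in (0:ℝ)..1, deriv F (z + (r : ℂ) * s) i) ^ 2).re ∧
    |(∑ i, (∫ r in (0:ℝ)..1, deriv F (z + (r : ℂ) * s) i) ^ 2).im| ≤ 2 * q * (ρ + 2 * e) := by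
  have hIcc : Set.uIcc (0:ℝ) 1 = Set.Icc 0 1 := uIcc_of_le zero_le_one
  set a : ℝ → (Fin 3 → ℂ) := fun r => deriv F (z + (r : ℂ) * s) with ha
  set W : Fin 3 → ℂ := fun i => ∫ r in (0:ℝ)..1, a r i with hW
  -- continuity along the segment
  have hdcont : ContinuousOn (deriv F) U := ((hF.analyticOnNhd hU).deriv).continuousOn
  have hpath_cont : Continuous fun r : ℝ => z + (r : ℂ) * s :=
    continuous_const.add (Complex.continuous_ofReal.mul continuous_const)
  have ha_cont : ContinuousOn a (uIcc 0 1) := by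
    rw [hIcc]; exact hdcont.comp hpath_cont.continuousOn fun r hr => hseg r hr
  have hai_cont : ∀ i, ContinuousOn (fun r => a r i) (uIcc 0 1) := fun i =>
    (continuous_apply i).comp_continuousOn ha_cont
  -- the pointwise pair estimates
  have hpair : ∀ r ∈ Icc (0:ℝ) 1, ∀ r' ∈ Icc (0:ℝ) 1,
      1 - (ρ + 2 * e) ^ 2 / 2 ≤ (∑ i, a r i * a r' i).re ∧ |(∑ i, a r i * a r' i).im| ≤ 2 * q * (ρ + 2 * e) := by
    intro r hr r' hr'
    have hu : ∑ i, (a r i) ^ 2 = 1 := hunit _ (hseg r hr)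
    have hu' : ∑ i, (a r' i) ^ 2 = 1 := hunit _ (hseg r' hr')
    refine ⟨?_, ?_⟩
    · have h := re_dot_ge_of_le (a r) (a r') (T r) (T r') hu hu' (hT r hr) (hT r' hr') (hρ r hr r' hr') (he r hr) (he r' hr')
      have : ρ + e + e = ρ + 2 * e := by ring
      rw [this] at h; exact h
    · have h := abs_im_dot_le_of_le (a r) (a r') (T r) (T r') hu hu' (hρ r hr r' hr') (he r hr) (he r' hr') (hq r hr) (hq r' hr')
      have : (q + q) * (ρ + e + e) = 2 * q * (ρ + 2 * e) := by ring
      rw [this] at h; exact h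
  -- inner integral: ∑ᵢ aᵢ(r)·Wᵢ = ∫ ∑ᵢ aᵢ(r) aᵢ(r′) dr′
  have hinner_eq : ∀ r, ∑ i, a r i * W i = ∫ r' in (0:ℝ)..1, ∑ i, a r i * a r' i := by
    intro r
    rw [intervalIntegral.integral_finsetSum fun i _ => ((hai_cont i).intervalIntegrable.const_mul (a r i))]
    refine Finset.sum_congr rfl fun i _ => ?_
    simp only [hW]
    exact (intervalIntegral.integral_const_mul (a r i) _).symm
  have hinner_cont : ∀ r, ContinuousOn (fun r' => ∑ i, a r i * a r' i) (uIcc (0:ℝ) 1) := fun r =>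
    continuousOn_finsetSum _ fun i _ => (continuousOn_const.mul (hai_cont i))
  have hinner : ∀ r ∈ Icc (0:ℝ) 1,
      1 - (ρ + 2 * e) ^ 2 / 2 ≤ (∑ i, a r i * W i).re ∧ |(∑ i, a r i * W i).im| ≤ 2 * q * (ρ + 2 * e) := by
    intro r hr
    rw [hinner_eq r]
    exact ⟨le_re_integral_of_le (hinner_cont r) fun r' hr' => (hpair r hr r' hr').1,
      abs_im_integral_le_of_le (hinner_cont r) fun r' hr' => (hpair r hr r' hr').2⟩
  -- outer integral: P = ∑ Wᵢ² = ∫ ∑ᵢ aᵢ(r) Wᵢ dr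
  have houter_eq : ∑ i, (W i) ^ 2 = ∫ r in (0:ℝ)..1, ∑ i, a r i * W i := by
    rw [intervalIntegral.integral_finsetSum fun i _ => ((hai_cont i).intervalIntegrable.mul_const (W i))]
    refine Finset.sum_congr rfl fun i _ => ?_
    rw [sq]
    simp only [hW]
    exact (intervalIntegral.integral_mul_const (W i) _).symm
  have houter_cont : ContinuousOn (fun r => ∑ i, a r i * W i) (uIcc (0:ℝ) 1) :=
    continuousOn_finsetSum _ fun i _ => ((hai_cont i).mul continuousOn_const)
  have hP : 1 - (ρ + 2 * e) ^ 2 / 2 ≤ (∑ i, (W i) ^ 2).re ∧ |(∑ i, (W i) ^ 2).im| ≤ 2 * q * (ρ + 2 * e) := by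
    rw [houter_eq]
    exact ⟨le_re_integral_of_le houter_cont fun r hr => (hinner r hr).1,
      abs_im_integral_le_of_le houter_cont fun r hr => (hinner r hr).2⟩
  simpa only [hW, ha] using hP

/-- **Sharp complexified-chord positivity along a complex segment.**  Under the hypotheses of `segment_mean_sq_bounds` and for a
displacement with `0 ≤ Re(s²)`: `Re(s²)·(1 − (ρ+2e)²/2) − |Im(s²)|·(2q(ρ+2e)) ≤ Re ∑ᵢ (Fᵢ(z+s) − Fᵢ(z))²`. [folklore] -/
theorem segment_chord_re_ge {U : Set ℂ} (hU : IsOpen U) {F : ℂ → (Fin 3 → ℂ)} (hF : DifferentiableOn ℂ F U)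
    (hunit : ∀ w ∈ U, ∑ i, (deriv F w i) ^ 2 = 1) {z s : ℂ} (hseg : ∀ r ∈ Icc (0:ℝ) 1, z + (r : ℂ) * s ∈ U)
    (T : ℝ → Fin 3 → ℝ) (hT : ∀ r ∈ Icc (0:ℝ) 1, ∑ i, T r i ^ 2 = 1) {ρ e q : ℝ}
    (hρ : ∀ r ∈ Icc (0:ℝ) 1, ∀ r' ∈ Icc (0:ℝ) 1, √(∑ i, (T r i - T r' i) ^ 2) ≤ ρ)
    (he : ∀ r ∈ Icc (0:ℝ) 1, √(∑ i, ((deriv F (z + (r : ℂ) * s) i).re - T r i) ^ 2) ≤ e)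
    (hq : ∀ r ∈ Icc (0:ℝ) 1, √(∑ i, (deriv F (z + (r : ℂ) * s) i).im ^ 2) ≤ q)
    (hs : 0 ≤ (s ^ 2).re) :
    (s ^ 2).re * (1 - (ρ + 2 * e) ^ 2 / 2) - |(s ^ 2).im| * (2 * q * (ρ + 2 * e)) ≤
      (∑ i, (F (z + s) i - F z i) ^ 2).re := by
  have hIcc : Set.uIcc (0:ℝ) 1 = Set.Icc 0 1 := uIcc_of_le zero_le_one
  set a : ℝ → (Fin 3 → ℂ) := fun r => deriv F (z + (r : ℂ) * s) with ha
  set W : Fin 3 → ℂ := fun i => ∫ r in (0:ℝ)..1, a r i with hW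
  have hdcont : ContinuousOn (deriv F) U := ((hF.analyticOnNhd hU).deriv).continuousOn
  have hpath_cont : Continuous fun r : ℝ => z + (r : ℂ) * s :=
    continuous_const.add (Complex.continuous_ofReal.mul continuous_const)
  have ha_cont : ContinuousOn a (uIcc 0 1) := by
    rw [hIcc]; exact hdcont.comp hpath_cont.continuousOn fun r hr => hseg r hr
  have hai_cont : ∀ i, ContinuousOn (fun r => a r i) (uIcc 0 1) := fun i =>
    (continuous_apply i).comp_continuousOn ha_cont
  -- derivative of the path and the fundamental theorem of calculus, componentwise
  have hderiv : ∀ r ∈ uIcc (0:ℝ) 1, HasDerivAt (fun r : ℝ => F (z + (r : ℂ) * s)) (s • a r) r := by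
    intro r hr
    rw [hIcc] at hr
    have hFd : HasDerivAt F (deriv F (z + (r : ℂ) * s)) (z + (r : ℂ) * s) :=
      (hF.differentiableAt (hU.mem_nhds (hseg r hr))).hasDerivAt
    have hp : HasDerivAt (fun r : ℝ => z + (r : ℂ) * s) s r := by
      have h1 := (((hasDerivAt_id r).ofReal_comp).mul_const s).const_add z
      simpa using h1
    exact hFd.scomp r hp
  have hFTC : ∀ i, F (z + s) i - F z i = s * W i := by
    intro i
    have hci : ∀ r ∈ uIcc (0:ℝ) 1, HasDerivAt (fun r : ℝ => F (z + (r : ℂ) * s) i) (s * a r i) r := by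
      intro r hr
      have h := (hasDerivAt_pi.1 (hderiv r hr)) i
      simpa [Pi.smul_apply, smul_eq_mul] using h
    have hint : IntervalIntegrable (fun r => s * a r i) MeasureTheory.volume 0 1 :=
      ((hai_cont i).intervalIntegrable).const_mul s
    have h := intervalIntegral.integral_eq_sub_of_hasDerivAt hci hint
    rw [intervalIntegral.integral_const_mul] at h
    rw [h]; simp
  -- `Q = s²·P`
  have hQ : (∑ i, (F (z + s) i - F z i) ^ 2) = s ^ 2 * ∑ i, (W i) ^ 2 := by
    rw [Finset.mul_sum]
    refine Finset.sum_congr rfl fun i _ => ?_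
    rw [hFTC i]; ring
  have hP := segment_mean_sq_bounds hU hF hunit hseg T hT hρ he hq
  set P : ℂ := ∑ i, (W i) ^ 2 with hPdef
  have hP1 : 1 - (ρ + 2 * e) ^ 2 / 2 ≤ P.re := by simpa only [hPdef, hW, ha] using hP.1
  have hP2 : |P.im| ≤ 2 * q * (ρ + 2 * e) := by simpa only [hPdef, hW, ha] using hP.2
  rw [hQ, Complex.mul_re]
  have h1 : (s ^ 2).re * (1 - (ρ + 2 * e) ^ 2 / 2) ≤ (s ^ 2).re * P.re := mul_le_mul_of_nonneg_left hP1 hs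
  have h2 : (s ^ 2).im * P.im ≤ |(s ^ 2).im| * (2 * q * (ρ + 2 * e)) := by
    calc (s ^ 2).im * P.im ≤ |(s ^ 2).im * P.im| := le_abs_self _
      _ = |(s ^ 2).im| * |P.im| := abs_mul _ _
      _ ≤ |(s ^ 2).im| * (2 * q * (ρ + 2 * e)) := mul_le_mul_of_nonneg_left hP2 (abs_nonneg _)
  linarith

/-- **Horizontal chords** (`s` real): `s²·(1 − (ρ+2e)²/2) ≤ Re Q` — NO hypothesis on the imaginary part of `F′` beyond a bound that is not
used (take `q` = any bound). [folklore] -/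
theorem horizontal_chord_re_ge {U : Set ℂ} (hU : IsOpen U) {F : ℂ → (Fin 3 → ℂ)} (hF : DifferentiableOn ℂ F U)
    (hunit : ∀ w ∈ U, ∑ i, (deriv F w i) ^ 2 = 1) {z : ℂ} {s : ℝ} (hseg : ∀ r ∈ Icc (0:ℝ) 1, z + (r : ℂ) * (s : ℂ) ∈ U)
    (T : ℝ → Fin 3 → ℝ) (hT : ∀ r ∈ Icc (0:ℝ) 1, ∑ i, T r i ^ 2 = 1) {ρ e : ℝ}
    (hρ : ∀ r ∈ Icc (0:ℝ) 1, ∀ r' ∈ Icc (0:ℝ) 1, √(∑ i, (T r i - T r' i) ^ 2) ≤ ρ)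
    (he : ∀ r ∈ Icc (0:ℝ) 1, √(∑ i, ((deriv F (z + (r : ℂ) * (s : ℂ)) i).re - T r i) ^ 2) ≤ e) :
    s ^ 2 * (1 - (ρ + 2 * e) ^ 2 / 2) ≤ (∑ i, (F (z + (s : ℂ)) i - F z i) ^ 2).re := by
  -- a trivially valid bound on the imaginary parts: the sup over the (compact) segment is not needed, any pointwise bound works with `Im(s²)=0`
  have hq : ∀ r ∈ Icc (0:ℝ) 1, √(∑ i, (deriv F (z + (r : ℂ) * (s : ℂ)) i).im ^ 2) ≤
      √(∑ i, (deriv F (z + (r : ℂ) * (s : ℂ)) i).im ^ 2) := fun r _ => le_rfl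
  have hs2 : ((s : ℂ) ^ 2).re = s ^ 2 := by
    rw [← Complex.ofReal_pow]; exact Complex.ofReal_re _
  have hs2i : ((s : ℂ) ^ 2).im = 0 := by
    rw [← Complex.ofReal_pow]; exact Complex.ofReal_im _
  -- pointwise-in-r bound `q r`: we use the segment lemma with `q` = 0-cost since `Im(s²) = 0`; pick `q := 0`-independent form via each r
  -- (the lemma needs ONE constant `q`; take the bound at `r` itself is not uniform — instead use any upper bound, e.g. the pi-norm of `F′`, but
  -- simplest: apply `segment_chord_re_ge` with `q := q₀` where `q₀` majorises all values; we avoid compactness by noting the `q`-term vanishes.)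
  have key : ∀ q₀ : ℝ, (∀ r ∈ Icc (0:ℝ) 1, √(∑ i, (deriv F (z + (r : ℂ) * (s : ℂ)) i).im ^ 2) ≤ q₀) →
      s ^ 2 * (1 - (ρ + 2 * e) ^ 2 / 2) ≤ (∑ i, (F (z + (s : ℂ)) i - F z i) ^ 2).re := by
    intro q₀ hq₀
    have h := segment_chord_re_ge hU hF hunit hseg T hT hρ he hq₀ (by rw [hs2]; positivity)
    rw [hs2, hs2i, abs_zero, zero_mul, sub_zero] at h
    exact h
  -- a uniform bound exists by continuity on the compact segment
  have hIcc : Set.uIcc (0:ℝ) 1 = Set.Icc 0 1 := uIcc_of_le zero_le_one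
  have hdcont : ContinuousOn (deriv F) U := ((hF.analyticOnNhd hU).deriv).continuousOn
  have hpath_cont : Continuous fun r : ℝ => z + (r : ℂ) * (s : ℂ) :=
    continuous_const.add (Complex.continuous_ofReal.mul continuous_const)
  have ha_cont : ContinuousOn (fun r : ℝ => deriv F (z + (r : ℂ) * (s : ℂ))) (Icc (0:ℝ) 1) :=
    hdcont.comp hpath_cont.continuousOn fun r hr => hseg r hr
  obtain ⟨C, hC⟩ := (isCompact_Icc.image_of_continuousOn ha_cont).isBounded.exists_norm_le
  refine key (√(3 * C ^ 2)) fun r hr => ?_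
  have hn : ‖deriv F (z + (r : ℂ) * (s : ℂ))‖ ≤ C := hC _ ⟨r, hr, rfl⟩
  have hterm : ∀ i, (deriv F (z + (r : ℂ) * (s : ℂ)) i).im ^ 2 ≤ C ^ 2 := by
    intro i
    have h1 : |(deriv F (z + (r : ℂ) * (s : ℂ)) i).im| ≤ C :=
      ((Complex.abs_im_le_norm _).trans (norm_le_pi_norm _ i)).trans hn
    exact sq_le_sq' (by linarith [neg_abs_le ((deriv F (z + (r : ℂ) * (s : ℂ)) i).im)]) ((le_abs_self _).trans h1)
  have hsum : ∑ i, (deriv F (z + (r : ℂ) * (s : ℂ)) i).im ^ 2 ≤ 3 * C ^ 2 :=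
    calc ∑ i, (deriv F (z + (r : ℂ) * (s : ℂ)) i).im ^ 2 ≤ ∑ _i : Fin 3, C ^ 2 := Finset.sum_le_sum fun i _ => hterm i
      _ = 3 * C ^ 2 := by simp
  exact Real.sqrt_le_sqrt hsum

end Summit.NavierStokesRegularity.NavierStokesRegularity.Theorems.StadiumSegmentPositivity

end
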